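import Summits.HodgeConjecture.HodgeConjecture.Theorems.Ring2WeilNormObstructionDescent
import Summits.HodgeConjecture.HodgeConjecture.Theorems.Ring2WeilCoverageNormCriteria
import HarnessLib

/-!
# Non-split certificates for the genus fields of the census, part B (`d = 13, 15` with `h_K = 2`; `d = 23` with `h_K = 3`)

research route conditional on HC_CM; not a corollary; Q11.4-sentence-2 already refuted in dim ≥ 3.

Cell `pub-hodge-ring2`, binder seat `ring2-b02` (gen 50), WEIL-TYPE FAMILY-COVERAGE CENSUS
(`run/shared/lean/pub/pub-hodge-ring2/WEIL-FAMILY-COVERAGE.md` §b02.4 compact rows). Companion of this seat's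
`Ring2WeilNormObstructionDescentCensus` (the 16 TARGET rows) and of ring2-b04's `Ring2WeilCoverageNormTable`
(square-free `a ≤ 15` on `d ∈ {1, 2, 3}`): here the NON-SPLIT certificates `a ∉ Nm(K_dˣ)`, `K_d = ℚ(√-d)`
(`Motives.normUnitsSubgroup ℚ (VanGeemen1994.weilField d)`), and the sixfold / tenfold class form
`[-a] ≠ Ring2.Hypotheses.splitDiscriminantClass n d` (every ODD `n`), for the classes listed below — each by ONE
prime of the obstruction set `T(a) = {p : (a, -d)_p = -1}`: an INERT prime `p ∥ a` (ring2-b04's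
`Ring2.WeilCoverage.natCast_not_mem_normUnitsSubgroup_of_inert`: `-d` non-square mod `p`) or, when both primes of
`T(a)` ramify, a RAMIFIED `p ∣ d`, `p ∤ a` with `a` non-square mod `p` (`…_of_ramified`); the class form by this
seat's `Ring2WeilNormDescent.mk_neg_ne_splitDiscriminantClass_of_odd`. Nothing here is about Hodge classes: these are
the arithmetic «(F1) NO hyperbolic member» cells of the census (Landherr / van Geemen (5.4.1): hyperbolic ⟺ `a ∈ Nm(K^×)`,
in the tree `VanGeemen1994.isHyperbolicWeilType_iff_hasWeilDiscriminantNondeg_split`).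

| `K` | `d` | `a` (least square-free representative) | `T(a)` | certificate prime |
|---|---|---|---|---|
| `ℚ(√-13)` | 13 | 3 | {2, 3} | inert 3 |
| `ℚ(√-13)` | 13 | 10 | {2, 5} | inert 5 |
| `ℚ(√-13)` | 13 | 2 | {2, 13} | ram 13 |
| `ℚ(√-13)` | 13 | 23 | {2, 23} | inert 23 |
| `ℚ(√-13)` | 13 | 30 | {3, 5} | inert 3 |
| `ℚ(√-13)` | 13 | 6 | {3, 13} | inert 3 |
| `ℚ(√-15)` | 15 | 2 | {3, 5} | ram 3 |
| `ℚ(√-15)` | 15 | 14 | {3, 7} | inert 7 |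
| `ℚ(√-15)` | 15 | 11 | {3, 11} | inert 11 |
| `ℚ(√-15)` | 15 | 26 | {3, 13} | inert 13 |
| `ℚ(√-15)` | 15 | 7 | {5, 7} | inert 7 |
| `ℚ(√-15)` | 15 | 22 | {5, 11} | inert 11 |
| `ℚ(√-23)` | 23 | 35 | {5, 7} | inert 5 |
| `ℚ(√-23)` | 23 | 55 | {5, 11} | inert 5 |
| `ℚ(√-23)` | 23 | 85 | {5, 17} | inert 5 |
| `ℚ(√-23)` | 23 | 95 | {5, 19} | inert 5 |
| `ℚ(√-23)` | 23 | 77 | {7, 11} | inert 7 |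
| `ℚ(√-23)` | 23 | 119 | {7, 17} | inert 7 |

## References
* B. van Geemen, LNM 1594 (1994), Lemma 5.2, 5.4 and (5.4.1) (after W. Landherr 1936). [vanGeemen1994HodgeAV]
* J.-P. Serre, *A Course in Arithmetic* (1973), Ch. III §1 (Hilbert symbols). [Serre1973]
-/

open Literature.AlgebraicGeometry.Motives
open Literature.AlgebraicGeometry.VanGeemen1994
open Summit.HodgeConjecture.HodgeConjecture.Ring2.Hypotheses
open Summit.HodgeConjecture.HodgeConjecture.Ring2.WeilCoverage

namespace Summit.HodgeConjecture.Ring2WeilNormDescent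

/-! ### `K = ℚ(√-13)` (`d = 13`; first five non-split primes `S₅ = [2, 3, 5, 13, 23]`) -/

namespace SqrtNeg13

/-- `3 ∉ Nm(ℚ(√-13)ˣ)`, `T(3) = {2, 3}`, at the inert prime `3 ∥ 3` (`-13` non-square mod `3`). research route conditional on HC_CM; not a corollary; Q11.4-sentence-2 already refuted in dim ≥ 3. [cite: vanGeemen1994HodgeAV, (5.4.1)] -/
theorem not_mem_3 : Units.mk0 (3 : ℚ) (by norm_num) ∉ normUnitsSubgroup ℚ (weilField 13) := by
  simpa using natCast_not_mem_normUnitsSubgroup_of_inert (d := 13) (a := 3) (p := 3)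
    (by norm_num) (by decide) (by norm_num) (by norm_num) (by norm_num)

/-- `[-3] ≠ split`: the components `(n, ℚ(√-13), a ≡ 3)`, `n` odd, have NO hyperbolic member (row W6.13.3). research route conditional on HC_CM; not a corollary; Q11.4-sentence-2 already refuted in dim ≥ 3. [cite: vanGeemen1994HodgeAV, (5.4.1)] -/
theorem neg_3_ne_split_of_odd {n : ℕ} (hn : Odd n) :
    (QuotientGroup.mk (Units.mk0 (-3 : ℚ) (by norm_num)) : weilNormResidueGroup 13) ≠ splitDiscriminantClass n 13 :=
  mk_neg_ne_splitDiscriminantClass_of_odd _ not_mem_3 hn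

/-- `10 ∉ Nm(ℚ(√-13)ˣ)`, `T(10) = {2, 5}`, at the inert prime `5 ∥ 10` (`-13` non-square mod `5`). research route conditional on HC_CM; not a corollary; Q11.4-sentence-2 already refuted in dim ≥ 3. [cite: vanGeemen1994HodgeAV, (5.4.1)] -/
theorem not_mem_10 : Units.mk0 (10 : ℚ) (by norm_num) ∉ normUnitsSubgroup ℚ (weilField 13) := by
  simpa using natCast_not_mem_normUnitsSubgroup_of_inert (d := 13) (a := 10) (p := 5)
    (by norm_num) (by decide) (by norm_num) (by norm_num) (by norm_num)

/-- `[-10] ≠ split`: the components `(n, ℚ(√-13), a ≡ 10)`, `n` odd, have NO hyperbolic member (row W6.13.10). research route conditional on HC_CM; not a corollary; Q11.4-sentence-2 already refuted in dim ≥ 3. [cite: vanGeemen1994HodgeAV, (5.4.1)] -/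
theorem neg_10_ne_split_of_odd {n : ℕ} (hn : Odd n) :
    (QuotientGroup.mk (Units.mk0 (-10 : ℚ) (by norm_num)) : weilNormResidueGroup 13) ≠ splitDiscriminantClass n 13 :=
  mk_neg_ne_splitDiscriminantClass_of_odd _ not_mem_10 hn

/-- `2 ∉ Nm(ℚ(√-13)ˣ)`, `T(2) = {2, 13}`, at the ramified prime `13 ∣ 13`, `2` non-square mod `13` (both primes of `T` ramify). research route conditional on HC_CM; not a corollary; Q11.4-sentence-2 already refuted in dim ≥ 3. [cite: vanGeemen1994HodgeAV, (5.4.1)] -/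
theorem not_mem_2 : Units.mk0 (2 : ℚ) (by norm_num) ∉ normUnitsSubgroup ℚ (weilField 13) := by
  simpa using natCast_not_mem_normUnitsSubgroup_of_ramified (d := 13) (a := 2) (p := 13)
    (by norm_num) (by norm_num) (by norm_num) (by decide) (by norm_num)

/-- `[-2] ≠ split`: the components `(n, ℚ(√-13), a ≡ 2)`, `n` odd, have NO hyperbolic member (row W6.13.2). research route conditional on HC_CM; not a corollary; Q11.4-sentence-2 already refuted in dim ≥ 3. [cite: vanGeemen1994HodgeAV, (5.4.1)] -/
theorem neg_2_ne_split_of_odd {n : ℕ} (hn : Odd n) :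
    (QuotientGroup.mk (Units.mk0 (-2 : ℚ) (by norm_num)) : weilNormResidueGroup 13) ≠ splitDiscriminantClass n 13 :=
  mk_neg_ne_splitDiscriminantClass_of_odd _ not_mem_2 hn

/-- `23 ∉ Nm(ℚ(√-13)ˣ)`, `T(23) = {2, 23}`, at the inert prime `23 ∥ 23` (`-13` non-square mod `23`). research route conditional on HC_CM; not a corollary; Q11.4-sentence-2 already refuted in dim ≥ 3. [cite: vanGeemen1994HodgeAV, (5.4.1)] -/
theorem not_mem_23 : Units.mk0 (23 : ℚ) (by norm_num) ∉ normUnitsSubgroup ℚ (weilField 13) := by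
  simpa using natCast_not_mem_normUnitsSubgroup_of_inert (d := 13) (a := 23) (p := 23)
    (by norm_num) (by decide) (by norm_num) (by norm_num) (by norm_num)

/-- `[-23] ≠ split`: the components `(n, ℚ(√-13), a ≡ 23)`, `n` odd, have NO hyperbolic member (row W6.13.23). research route conditional on HC_CM; not a corollary; Q11.4-sentence-2 already refuted in dim ≥ 3. [cite: vanGeemen1994HodgeAV, (5.4.1)] -/
theorem neg_23_ne_split_of_odd {n : ℕ} (hn : Odd n) :
    (QuotientGroup.mk (Units.mk0 (-23 : ℚ) (by norm_num)) : weilNormResidueGroup 13) ≠ splitDiscriminantClass n 13 :=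
  mk_neg_ne_splitDiscriminantClass_of_odd _ not_mem_23 hn

/-- `30 ∉ Nm(ℚ(√-13)ˣ)`, `T(30) = {3, 5}`, at the inert prime `3 ∥ 30` (`-13` non-square mod `3`). research route conditional on HC_CM; not a corollary; Q11.4-sentence-2 already refuted in dim ≥ 3. [cite: vanGeemen1994HodgeAV, (5.4.1)] -/
theorem not_mem_30 : Units.mk0 (30 : ℚ) (by norm_num) ∉ normUnitsSubgroup ℚ (weilField 13) := by
  simpa using natCast_not_mem_normUnitsSubgroup_of_inert (d := 13) (a := 30) (p := 3)
    (by norm_num) (by decide) (by norm_num) (by norm_num) (by norm_num)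

/-- `[-30] ≠ split`: the components `(n, ℚ(√-13), a ≡ 30)`, `n` odd, have NO hyperbolic member (row W6.13.30). research route conditional on HC_CM; not a corollary; Q11.4-sentence-2 already refuted in dim ≥ 3. [cite: vanGeemen1994HodgeAV, (5.4.1)] -/
theorem neg_30_ne_split_of_odd {n : ℕ} (hn : Odd n) :
    (QuotientGroup.mk (Units.mk0 (-30 : ℚ) (by norm_num)) : weilNormResidueGroup 13) ≠ splitDiscriminantClass n 13 :=
  mk_neg_ne_splitDiscriminantClass_of_odd _ not_mem_30 hn

/-- `6 ∉ Nm(ℚ(√-13)ˣ)`, `T(6) = {3, 13}`, at the inert prime `3 ∥ 6` (`-13` non-square mod `3`). research route conditional on HC_CM; not a corollary; Q11.4-sentence-2 already refuted in dim ≥ 3. [cite: vanGeemen1994HodgeAV, (5.4.1)] -/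
theorem not_mem_6 : Units.mk0 (6 : ℚ) (by norm_num) ∉ normUnitsSubgroup ℚ (weilField 13) := by
  simpa using natCast_not_mem_normUnitsSubgroup_of_inert (d := 13) (a := 6) (p := 3)
    (by norm_num) (by decide) (by norm_num) (by norm_num) (by norm_num)

/-- `[-6] ≠ split`: the components `(n, ℚ(√-13), a ≡ 6)`, `n` odd, have NO hyperbolic member (row W6.13.6). research route conditional on HC_CM; not a corollary; Q11.4-sentence-2 already refuted in dim ≥ 3. [cite: vanGeemen1994HodgeAV, (5.4.1)] -/
theorem neg_6_ne_split_of_odd {n : ℕ} (hn : Odd n) :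
    (QuotientGroup.mk (Units.mk0 (-6 : ℚ) (by norm_num)) : weilNormResidueGroup 13) ≠ splitDiscriminantClass n 13 :=
  mk_neg_ne_splitDiscriminantClass_of_odd _ not_mem_6 hn

end SqrtNeg13

/-! ### `K = ℚ(√-15)` (`d = 15`; first five non-split primes `S₅ = [3, 5, 7, 11, 13]`) -/

namespace SqrtNeg15

/-- `2 ∉ Nm(ℚ(√-15)ˣ)`, `T(2) = {3, 5}`, at the ramified prime `3 ∣ 15`, `2` non-square mod `3` (both primes of `T` ramify). research route conditional on HC_CM; not a corollary; Q11.4-sentence-2 already refuted in dim ≥ 3. [cite: vanGeemen1994HodgeAV, (5.4.1)] -/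
theorem not_mem_2 : Units.mk0 (2 : ℚ) (by norm_num) ∉ normUnitsSubgroup ℚ (weilField 15) := by
  simpa using natCast_not_mem_normUnitsSubgroup_of_ramified (d := 15) (a := 2) (p := 3)
    (by norm_num) (by norm_num) (by norm_num) (by decide) (by norm_num)

/-- `[-2] ≠ split`: the components `(n, ℚ(√-15), a ≡ 2)`, `n` odd, have NO hyperbolic member (row W6.15.2). research route conditional on HC_CM; not a corollary; Q11.4-sentence-2 already refuted in dim ≥ 3. [cite: vanGeemen1994HodgeAV, (5.4.1)] -/
theorem neg_2_ne_split_of_odd {n : ℕ} (hn : Odd n) :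
    (QuotientGroup.mk (Units.mk0 (-2 : ℚ) (by norm_num)) : weilNormResidueGroup 15) ≠ splitDiscriminantClass n 15 :=
  mk_neg_ne_splitDiscriminantClass_of_odd _ not_mem_2 hn

/-- `14 ∉ Nm(ℚ(√-15)ˣ)`, `T(14) = {3, 7}`, at the inert prime `7 ∥ 14` (`-15` non-square mod `7`). research route conditional on HC_CM; not a corollary; Q11.4-sentence-2 already refuted in dim ≥ 3. [cite: vanGeemen1994HodgeAV, (5.4.1)] -/
theorem not_mem_14 : Units.mk0 (14 : ℚ) (by norm_num) ∉ normUnitsSubgroup ℚ (weilField 15) := by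
  simpa using natCast_not_mem_normUnitsSubgroup_of_inert (d := 15) (a := 14) (p := 7)
    (by norm_num) (by decide) (by norm_num) (by norm_num) (by norm_num)

/-- `[-14] ≠ split`: the components `(n, ℚ(√-15), a ≡ 14)`, `n` odd, have NO hyperbolic member (row W6.15.14). research route conditional on HC_CM; not a corollary; Q11.4-sentence-2 already refuted in dim ≥ 3. [cite: vanGeemen1994HodgeAV, (5.4.1)] -/
theorem neg_14_ne_split_of_odd {n : ℕ} (hn : Odd n) :
    (QuotientGroup.mk (Units.mk0 (-14 : ℚ) (by norm_num)) : weilNormResidueGroup 15) ≠ splitDiscriminantClass n 15 :=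
  mk_neg_ne_splitDiscriminantClass_of_odd _ not_mem_14 hn

/-- `11 ∉ Nm(ℚ(√-15)ˣ)`, `T(11) = {3, 11}`, at the inert prime `11 ∥ 11` (`-15` non-square mod `11`). research route conditional on HC_CM; not a corollary; Q11.4-sentence-2 already refuted in dim ≥ 3. [cite: vanGeemen1994HodgeAV, (5.4.1)] -/
theorem not_mem_11 : Units.mk0 (11 : ℚ) (by norm_num) ∉ normUnitsSubgroup ℚ (weilField 15) := by
  simpa using natCast_not_mem_normUnitsSubgroup_of_inert (d := 15) (a := 11) (p := 11)
    (by norm_num) (by decide) (by norm_num) (by norm_num) (by norm_num)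

/-- `[-11] ≠ split`: the components `(n, ℚ(√-15), a ≡ 11)`, `n` odd, have NO hyperbolic member (row W6.15.11). research route conditional on HC_CM; not a corollary; Q11.4-sentence-2 already refuted in dim ≥ 3. [cite: vanGeemen1994HodgeAV, (5.4.1)] -/
theorem neg_11_ne_split_of_odd {n : ℕ} (hn : Odd n) :
    (QuotientGroup.mk (Units.mk0 (-11 : ℚ) (by norm_num)) : weilNormResidueGroup 15) ≠ splitDiscriminantClass n 15 :=
  mk_neg_ne_splitDiscriminantClass_of_odd _ not_mem_11 hn

/-- `26 ∉ Nm(ℚ(√-15)ˣ)`, `T(26) = {3, 13}`, at the inert prime `13 ∥ 26` (`-15` non-square mod `13`). research route conditional on HC_CM; not a corollary; Q11.4-sentence-2 already refuted in dim ≥ 3. [cite: vanGeemen1994HodgeAV, (5.4.1)] -/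
theorem not_mem_26 : Units.mk0 (26 : ℚ) (by norm_num) ∉ normUnitsSubgroup ℚ (weilField 15) := by
  simpa using natCast_not_mem_normUnitsSubgroup_of_inert (d := 15) (a := 26) (p := 13)
    (by norm_num) (by decide) (by norm_num) (by norm_num) (by norm_num)

/-- `[-26] ≠ split`: the components `(n, ℚ(√-15), a ≡ 26)`, `n` odd, have NO hyperbolic member (row W6.15.26). research route conditional on HC_CM; not a corollary; Q11.4-sentence-2 already refuted in dim ≥ 3. [cite: vanGeemen1994HodgeAV, (5.4.1)] -/
theorem neg_26_ne_split_of_odd {n : ℕ} (hn : Odd n) :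
    (QuotientGroup.mk (Units.mk0 (-26 : ℚ) (by norm_num)) : weilNormResidueGroup 15) ≠ splitDiscriminantClass n 15 :=
  mk_neg_ne_splitDiscriminantClass_of_odd _ not_mem_26 hn

/-- `7 ∉ Nm(ℚ(√-15)ˣ)`, `T(7) = {5, 7}`, at the inert prime `7 ∥ 7` (`-15` non-square mod `7`). research route conditional on HC_CM; not a corollary; Q11.4-sentence-2 already refuted in dim ≥ 3. [cite: vanGeemen1994HodgeAV, (5.4.1)] -/
theorem not_mem_7 : Units.mk0 (7 : ℚ) (by norm_num) ∉ normUnitsSubgroup ℚ (weilField 15) := by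
  simpa using natCast_not_mem_normUnitsSubgroup_of_inert (d := 15) (a := 7) (p := 7)
    (by norm_num) (by decide) (by norm_num) (by norm_num) (by norm_num)

/-- `[-7] ≠ split`: the components `(n, ℚ(√-15), a ≡ 7)`, `n` odd, have NO hyperbolic member (row W6.15.7). research route conditional on HC_CM; not a corollary; Q11.4-sentence-2 already refuted in dim ≥ 3. [cite: vanGeemen1994HodgeAV, (5.4.1)] -/
theorem neg_7_ne_split_of_odd {n : ℕ} (hn : Odd n) :
    (QuotientGroup.mk (Units.mk0 (-7 : ℚ) (by norm_num)) : weilNormResidueGroup 15) ≠ splitDiscriminantClass n 15 :=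
  mk_neg_ne_splitDiscriminantClass_of_odd _ not_mem_7 hn

/-- `22 ∉ Nm(ℚ(√-15)ˣ)`, `T(22) = {5, 11}`, at the inert prime `11 ∥ 22` (`-15` non-square mod `11`). research route conditional on HC_CM; not a corollary; Q11.4-sentence-2 already refuted in dim ≥ 3. [cite: vanGeemen1994HodgeAV, (5.4.1)] -/
theorem not_mem_22 : Units.mk0 (22 : ℚ) (by norm_num) ∉ normUnitsSubgroup ℚ (weilField 15) := by
  simpa using natCast_not_mem_normUnitsSubgroup_of_inert (d := 15) (a := 22) (p := 11)
    (by norm_num) (by decide) (by norm_num) (by norm_num) (by norm_num)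

/-- `[-22] ≠ split`: the components `(n, ℚ(√-15), a ≡ 22)`, `n` odd, have NO hyperbolic member (row W6.15.22). research route conditional on HC_CM; not a corollary; Q11.4-sentence-2 already refuted in dim ≥ 3. [cite: vanGeemen1994HodgeAV, (5.4.1)] -/
theorem neg_22_ne_split_of_odd {n : ℕ} (hn : Odd n) :
    (QuotientGroup.mk (Units.mk0 (-22 : ℚ) (by norm_num)) : weilNormResidueGroup 15) ≠ splitDiscriminantClass n 15 :=
  mk_neg_ne_splitDiscriminantClass_of_odd _ not_mem_22 hn

end SqrtNeg15

/-! ### `K = ℚ(√-23)` (`d = 23`; first five non-split primes `S₅ = [5, 7, 11, 17, 19]`) -/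

namespace SqrtNeg23

/-- `35 ∉ Nm(ℚ(√-23)ˣ)`, `T(35) = {5, 7}`, at the inert prime `5 ∥ 35` (`-23` non-square mod `5`). research route conditional on HC_CM; not a corollary; Q11.4-sentence-2 already refuted in dim ≥ 3. [cite: vanGeemen1994HodgeAV, (5.4.1)] -/
theorem not_mem_35 : Units.mk0 (35 : ℚ) (by norm_num) ∉ normUnitsSubgroup ℚ (weilField 23) := by
  simpa using natCast_not_mem_normUnitsSubgroup_of_inert (d := 23) (a := 35) (p := 5)
    (by norm_num) (by decide) (by norm_num) (by norm_num) (by norm_num)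

/-- `[-35] ≠ split`: the components `(n, ℚ(√-23), a ≡ 35)`, `n` odd, have NO hyperbolic member (row W6.23.35). research route conditional on HC_CM; not a corollary; Q11.4-sentence-2 already refuted in dim ≥ 3. [cite: vanGeemen1994HodgeAV, (5.4.1)] -/
theorem neg_35_ne_split_of_odd {n : ℕ} (hn : Odd n) :
    (QuotientGroup.mk (Units.mk0 (-35 : ℚ) (by norm_num)) : weilNormResidueGroup 23) ≠ splitDiscriminantClass n 23 :=
  mk_neg_ne_splitDiscriminantClass_of_odd _ not_mem_35 hn

/-- `55 ∉ Nm(ℚ(√-23)ˣ)`, `T(55) = {5, 11}`, at the inert prime `5 ∥ 55` (`-23` non-square mod `5`). research route conditional on HC_CM; not a corollary; Q11.4-sentence-2 already refuted in dim ≥ 3. [cite: vanGeemen1994HodgeAV, (5.4.1)] -/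
theorem not_mem_55 : Units.mk0 (55 : ℚ) (by norm_num) ∉ normUnitsSubgroup ℚ (weilField 23) := by
  simpa using natCast_not_mem_normUnitsSubgroup_of_inert (d := 23) (a := 55) (p := 5)
    (by norm_num) (by decide) (by norm_num) (by norm_num) (by norm_num)

/-- `[-55] ≠ split`: the components `(n, ℚ(√-23), a ≡ 55)`, `n` odd, have NO hyperbolic member (row W6.23.55). research route conditional on HC_CM; not a corollary; Q11.4-sentence-2 already refuted in dim ≥ 3. [cite: vanGeemen1994HodgeAV, (5.4.1)] -/
theorem neg_55_ne_split_of_odd {n : ℕ} (hn : Odd n) :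
    (QuotientGroup.mk (Units.mk0 (-55 : ℚ) (by norm_num)) : weilNormResidueGroup 23) ≠ splitDiscriminantClass n 23 :=
  mk_neg_ne_splitDiscriminantClass_of_odd _ not_mem_55 hn

/-- `85 ∉ Nm(ℚ(√-23)ˣ)`, `T(85) = {5, 17}`, at the inert prime `5 ∥ 85` (`-23` non-square mod `5`). research route conditional on HC_CM; not a corollary; Q11.4-sentence-2 already refuted in dim ≥ 3. [cite: vanGeemen1994HodgeAV, (5.4.1)] -/
theorem not_mem_85 : Units.mk0 (85 : ℚ) (by norm_num) ∉ normUnitsSubgroup ℚ (weilField 23) := by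
  simpa using natCast_not_mem_normUnitsSubgroup_of_inert (d := 23) (a := 85) (p := 5)
    (by norm_num) (by decide) (by norm_num) (by norm_num) (by norm_num)

/-- `[-85] ≠ split`: the components `(n, ℚ(√-23), a ≡ 85)`, `n` odd, have NO hyperbolic member (row W6.23.85). research route conditional on HC_CM; not a corollary; Q11.4-sentence-2 already refuted in dim ≥ 3. [cite: vanGeemen1994HodgeAV, (5.4.1)] -/
theorem neg_85_ne_split_of_odd {n : ℕ} (hn : Odd n) :
    (QuotientGroup.mk (Units.mk0 (-85 : ℚ) (by norm_num)) : weilNormResidueGroup 23) ≠ splitDiscriminantClass n 23 :=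
  mk_neg_ne_splitDiscriminantClass_of_odd _ not_mem_85 hn

/-- `95 ∉ Nm(ℚ(√-23)ˣ)`, `T(95) = {5, 19}`, at the inert prime `5 ∥ 95` (`-23` non-square mod `5`). research route conditional on HC_CM; not a corollary; Q11.4-sentence-2 already refuted in dim ≥ 3. [cite: vanGeemen1994HodgeAV, (5.4.1)] -/
theorem not_mem_95 : Units.mk0 (95 : ℚ) (by norm_num) ∉ normUnitsSubgroup ℚ (weilField 23) := by
  simpa using natCast_not_mem_normUnitsSubgroup_of_inert (d := 23) (a := 95) (p := 5)
    (by norm_num) (by decide) (by norm_num) (by norm_num) (by norm_num)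

/-- `[-95] ≠ split`: the components `(n, ℚ(√-23), a ≡ 95)`, `n` odd, have NO hyperbolic member (row W6.23.95). research route conditional on HC_CM; not a corollary; Q11.4-sentence-2 already refuted in dim ≥ 3. [cite: vanGeemen1994HodgeAV, (5.4.1)] -/
theorem neg_95_ne_split_of_odd {n : ℕ} (hn : Odd n) :
    (QuotientGroup.mk (Units.mk0 (-95 : ℚ) (by norm_num)) : weilNormResidueGroup 23) ≠ splitDiscriminantClass n 23 :=
  mk_neg_ne_splitDiscriminantClass_of_odd _ not_mem_95 hn

/-- `77 ∉ Nm(ℚ(√-23)ˣ)`, `T(77) = {7, 11}`, at the inert prime `7 ∥ 77` (`-23` non-square mod `7`). research route conditional on HC_CM; not a corollary; Q11.4-sentence-2 already refuted in dim ≥ 3. [cite: vanGeemen1994HodgeAV, (5.4.1)] -/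
theorem not_mem_77 : Units.mk0 (77 : ℚ) (by norm_num) ∉ normUnitsSubgroup ℚ (weilField 23) := by
  simpa using natCast_not_mem_normUnitsSubgroup_of_inert (d := 23) (a := 77) (p := 7)
    (by norm_num) (by decide) (by norm_num) (by norm_num) (by norm_num)

/-- `[-77] ≠ split`: the components `(n, ℚ(√-23), a ≡ 77)`, `n` odd, have NO hyperbolic member (row W6.23.77). research route conditional on HC_CM; not a corollary; Q11.4-sentence-2 already refuted in dim ≥ 3. [cite: vanGeemen1994HodgeAV, (5.4.1)] -/
theorem neg_77_ne_split_of_odd {n : ℕ} (hn : Odd n) :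
    (QuotientGroup.mk (Units.mk0 (-77 : ℚ) (by norm_num)) : weilNormResidueGroup 23) ≠ splitDiscriminantClass n 23 :=
  mk_neg_ne_splitDiscriminantClass_of_odd _ not_mem_77 hn

/-- `119 ∉ Nm(ℚ(√-23)ˣ)`, `T(119) = {7, 17}`, at the inert prime `7 ∥ 119` (`-23` non-square mod `7`). research route conditional on HC_CM; not a corollary; Q11.4-sentence-2 already refuted in dim ≥ 3. [cite: vanGeemen1994HodgeAV, (5.4.1)] -/
theorem not_mem_119 : Units.mk0 (119 : ℚ) (by norm_num) ∉ normUnitsSubgroup ℚ (weilField 23) := by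
  simpa using natCast_not_mem_normUnitsSubgroup_of_inert (d := 23) (a := 119) (p := 7)
    (by norm_num) (by decide) (by norm_num) (by norm_num) (by norm_num)

/-- `[-119] ≠ split`: the components `(n, ℚ(√-23), a ≡ 119)`, `n` odd, have NO hyperbolic member (row W6.23.119). research route conditional on HC_CM; not a corollary; Q11.4-sentence-2 already refuted in dim ≥ 3. [cite: vanGeemen1994HodgeAV, (5.4.1)] -/
theorem neg_119_ne_split_of_odd {n : ℕ} (hn : Odd n) :
    (QuotientGroup.mk (Units.mk0 (-119 : ℚ) (by norm_num)) : weilNormResidueGroup 23) ≠ splitDiscriminantClass n 23 :=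
  mk_neg_ne_splitDiscriminantClass_of_odd _ not_mem_119 hn

end SqrtNeg23

end Summit.HodgeConjecture.Ring2WeilNormDescent
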